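import Literature.MathematicalPhysics.QuantumFieldTheory.Balaban1983to89.Node00.CarriersY
import Literature.MathematicalPhysics.QuantumFieldTheory.Balaban1983to89.B9PinCarriersKLevelV1P

/-!
# NODE 00 (YM-PLAN Track A) — STAGE 3′(Y) OF THE CARRIERS OF RECORD, `…P` EDITION (dag-lead DEDUP-288 (1b) cascade (ii); node00-def-Y ANSWER-COVERAGE-1 ∕ INTENT-16-REVISED):
# the [Balaban1985BackgroundPropagators] bundle of record RE-PINNED to def-Y's `carriersYP` — the p. 396 class WITH PRINT'S SIZES AND PRINT'S PER-CUBE CONSTANT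
# (`B9PinCarriersKLevelV1P`) — `Y9OfRecordP`, and the cumulative Stage-9 record predicate with that bundle pinned, `IsRecordOfRecord₉CB10YP`

Cell `pub-ymgap`, seat `pub-ymgap-node00-def-K0a` (g9), FILE 19 of the K0a lineage = the `…P` IMAGE of node00-def g29's `Node00/CarriersY.lean` §1 + §3 under the token map
`carriersY ↦ carriersYP`, `Y9OfRecord ↦ Y9OfRecordP`, `IsRecordOfRecord₉CB10Y ↦ IsRecordOfRecord₉CB10YP` (+ the dotted lemma names), def-Y's knit `b9LeafX_carriersY ↦ b9LeafX_carriersYP`;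
§2 of `CarriersY` (the UP-SIDE pin `Residual₅.pinY ∕ Stage5Params.pinY ∕ Stage9Params.pinY` and its faces) is VALUE-GENERIC and is CITED, not re-issued; `OpsY` (the operator-layer type) is
CITED.  APPEND-ONLY: a NEW importing module; `CarriersY`, def-Y's modules and every consumer untouched (dag-n10-d's `…P` view faces and the N24 knits port on THEIR files, DEDUP-288 (1b)).
WHY: dag-n06-j LOCATED-COVERAGE-1 ∕ def-Y ANSWER-COVERAGE-1 — the recorded N06 sentence `B9LeafX (Y9OfRecord …)` reads def-Y's LITERAL p. 396 class `bg9Y`; the re-sized class of def-Y's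
`…P` modules is the one [B9] USES (pp. 404, 408–409); the re-pin of the OBJECT OF RECORD is this file's `Y9OfRecordP`.  Every landed N06 face over `Y9OfRecord` stays true and usable.
HONEST FRAMING: definitions + kernel bookkeeping (`rfl`, projections); NO estimate; no operator of [B9] defined; N06 NOT discharged; the leaf over `Y9OfRecordP` is closable by a junk
operator layer exactly as over `Y9OfRecord` (def-Y's non-vacuity witness) until that layer is an object of record; counts unmoved (typed 28∕28 · discharged 5∕28); one finite 𝕋⁴
programme at fixed ε — NOT continuum ∕ OS ∕ mass gap ∕ Clay.  No `sorry`, `axiom`, `instance`, `notation`.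
-/

noncomputable section

open MeasureTheory

namespace Literature.MathematicalPhysics.QuantumFieldTheory.Balaban1983to89.Node00

open T4Continuum AveragingRT T4FiniteEpsInhabited FlowStep FlowStepRuns DagBinding T4DatumAssembly
open B9PinCarriersKLevelV1 (OperatorLayerY)
open B9PinCarriersKLevelV1P (carriersYP)
open B9PinMembersKLevelV1 (MemberY)
open B7Prop2SpecialUnitary (specialUnitaryUnits)
open scoped Matrix.Norms.L2Operator

/-! ## §1. The [B9] bundle of record as a function of the Stage-3 dictionary, the floor `M⋆` and the operator layer -/

section Bundle

variable (N : ℕ)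

/-- **THE [B9] CARRIER BUNDLE OF RECORD** at `(θ, Mstar, ops)`: def-Y's `carriersYP` over the record's Stage-3 geometry, `M_N(ℂ)`, `SU(N)`, and the operator layer `ops`.
[cite: Balaban1985BackgroundPropagators, Thm 3.1 p.397 + p.399 (the family), Thms 3.1–3.15 pp.397–432 (the carriers of the typed statements)] -/
def Y9OfRecordP (θ : Stage3Params) (Mstar : ℕ) (ops : OpsY N θ Mstar) : PrintedCarriers9X :=
  carriersYP θ.d₆ θ.ℓ₆ θ.hd' θ.hL' θ.b₀ θ.b₁ Mstar (Matrix (Fin N) (Fin N) ℂ) (specialUnitaryUnits (Fin N)) ops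

/-- The bundle's index is def-Y's member type over the record's geometry (`rfl`). [cite: Balaban1985BackgroundPropagators, p.399 (bookkeeping)] -/
theorem Y9OfRecordP_I9 (θ : Stage3Params) (Mstar : ℕ) (ops : OpsY N θ Mstar) :
    (Y9OfRecordP N θ Mstar ops).I9 = MemberY θ.d₆ θ.ℓ₆ θ.hd' θ.hL' θ.b₀ θ.b₁ Mstar := rfl

/-- The bundle's index is inhabited whenever `L ≥ 5` (def-Y's guard; the band `0 < b₀ ≤ b₁` is the record's `Stage3Params.hb`). [cite: Balaban1985BackgroundPropagators, p.399 (the family is inhabited)] -/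
theorem Y9OfRecordP_nonempty_I9 (θ : Stage3Params) (Mstar : ℕ) (ops : OpsY N θ Mstar) (hℓ : 4 ≤ θ.ℓ₆) : Nonempty (Y9OfRecordP N θ Mstar ops).I9 :=
  B9PinCarriersKLevelV1P.carriersYP_nonempty_I9 _ hℓ θ.hb.1 θ.hb.2

end Bundle


/-! ## §3. The cumulative Stage-9 record with the [B10] AND [B9] groups pinned: `IsRecordOfRecord₉CB10YP` -/

section Record9

variable (F : T4Family) (N : ℕ) [NeZero N]

/-- **«(D, w) is the record, Stage 9, [B10] and [B9] groups pinned»** (CUMULATIVE): `IsRecordOfRecord₉CB10` VERBATIM except that the upstream block is the C-binding at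
the Stage-5 view pinned by `pinB10` THEN `pinY (Y9OfRecordP N θ.toStage3Params Mstar ops)` for SOME floor `Mstar` and SOME operator layer `ops` (residual data,
quantified with the record's parameters; no law on them is assumed). [cite: Balaban1985BackgroundPropagators, Thms 3.1–3.15 pp.397–432; Balaban1985UV3, Thm 1 p.257 + Thm 2 p.272; Balaban1989LargeFieldII, Thm 1 + (0.1) pp.355–356 (objects of record)] -/
def IsRecordOfRecord₉CB10YP (D : FiniteEpsData F (SU N)) (w : WorldP) : Prop :=
  ∃ (θ : Stage9Params F N) (h : θ.Provisos) (Mstar : ℕ) (ops : OpsY N θ.toStage3Params Mstar),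
    θ.Admissible ∧ D = datumOfRecord₉ F N θ h ∧ w.C = D.C ∧ (0 < w.γ ∧ w.γ ≤ θ.γ) ∧ w.L = (θ.L : ℝ) ∧
      ∀ P : B12.RunParams, w.up P = upOfRecord₅C F N (((θ.toStage5 F N).pinB10 F N).pinY F N (Y9OfRecordP N θ.toStage3Params Mstar ops)) P

/-- Pointed form. [cite: Balaban1989LargeFieldII, Thm 1 + (0.1) pp.355–356 (bookkeeping)] -/
theorem isRecordOfRecord₉CB10YP_of_eq (θ : Stage9Params F N) (h : θ.Provisos) (hθ : θ.Admissible) (Mstar : ℕ) (ops : OpsY N θ.toStage3Params Mstar)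
    (w : WorldP) (hC : w.C = (datumOfRecord₉ F N θ h).C) (hγ : 0 < w.γ ∧ w.γ ≤ θ.γ) (hL : w.L = (θ.L : ℝ))
    (hup : ∀ P, w.up P = upOfRecord₅C F N (((θ.toStage5 F N).pinB10 F N).pinY F N (Y9OfRecordP N θ.toStage3Params Mstar ops)) P) :
    IsRecordOfRecord₉CB10YP F N (datumOfRecord₉ F N θ h) w :=
  ⟨θ, h, Mstar, ops, hθ, rfl, hC, hγ, hL, hup⟩

/-- **Inhabitation is Stage 9's EXACTLY**: every admissible Stage-9 parameter with its provisos, ANY floor and ANY operator layer give a record of this module at some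
world, any window `0 < γw ≤ θ.γ`. [cite: Balaban1989LargeFieldII, Thm 1 + (0.1) pp.355–356 (bookkeeping)] -/
theorem exists_world_isRecordOfRecord₉CB10YP (θ : Stage9Params F N) (h : θ.Provisos) (hθ : θ.Admissible) (Mstar : ℕ)
    (ops : OpsY N θ.toStage3Params Mstar) {γw : ℝ} (hγw : 0 < γw ∧ γw ≤ θ.γ) :
    ∃ w : WorldP, IsRecordOfRecord₉CB10YP F N (datumOfRecord₉ F N θ h) w ∧ w.γ = γw := by
  obtain ⟨w₀, -, -⟩ := exists_world_isRecordOfRecord₉C F N θ h hθ hγw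
  exact ⟨{ w₀ with
      C := (datumOfRecord₉ F N θ h).C, γ := γw, L := (θ.L : ℝ), one_lt_L := by exact_mod_cast θ.hL.2,
      up := fun P => upOfRecord₅C F N (((θ.toStage5 F N).pinB10 F N).pinY F N (Y9OfRecordP N θ.toStage3Params Mstar ops)) P },
    ⟨θ, h, Mstar, ops, hθ, rfl, rfl, hγw, rfl, fun _ => rfl⟩, rfl⟩

variable {F N}
variable {D : FiniteEpsData F (SU N)} {w : WorldP}

/-- **Refinement `IsRecordOfRecord₉CB10YP → IsRecordOfRecord₉CB10`** with THE SAME datum AND world (witness `θ.pinY (Y9OfRecordP …)`; the pins commute).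
[cite: Balaban1985BackgroundPropagators, Thm 3.1 p.397 (bookkeeping)] -/
theorem isRecordOfRecord₉CB10_of_isRecordOfRecord₉CB10YP (h : IsRecordOfRecord₉CB10YP F N D w) : IsRecordOfRecord₉CB10 F N D w := by
  obtain ⟨θ, hP, Mstar, ops, hθ, hD, hC, hγ, hL, hup⟩ := h
  refine ⟨θ.pinY F N (Y9OfRecordP N θ.toStage3Params Mstar ops), hP.pinY _, hθ, ?_, hC, hγ, hL, fun P => ?_⟩
  · rw [datumOfRecord₉_pinY]; exact hD
  · rw [Stage9Params.toStage5_pinY, Stage5Params.pinY_pinB10]; exact hup P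

/-- … hence to `IsRecordOfRecord₉C` (and to `IsRecordOfRecord₅C` at Stage 9's shadow). [cite: Balaban1989LargeFieldII, Thm 1 p.355 (bookkeeping)] -/
theorem isRecordOfRecord₉C_of_isRecordOfRecord₉CB10YP (h : IsRecordOfRecord₉CB10YP F N D w) : IsRecordOfRecord₉C F N D w :=
  isRecordOfRecord₉C_of_isRecordOfRecord₉CB10 (isRecordOfRecord₉CB10_of_isRecordOfRecord₉CB10YP h)

/-- The `atWorld` transfer: every world-reading node theorem over `IsRecordOfRecord₅C` holds at every record of this module. [cite: Balaban1989LargeFieldII, Thm 1 p.355 (bookkeeping)] -/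
theorem atWorld_of_isRecordOfRecord₉CB10YP {X : Dag.Leaves → Prop}
    (h₅ : ∀ (D : FiniteEpsData F (SU N)) (w : WorldP), IsRecordOfRecord₅C F N D w → ∀ P : B12.RunParams, X (leavesP w P))
    (h : IsRecordOfRecord₉CB10YP F N D w) (P : B12.RunParams) : X (leavesP w P) :=
  atWorld_of_isRecordOfRecord₉C h₅ (isRecordOfRecord₉C_of_isRecordOfRecord₉CB10YP h) P

/-- Conversely, RE-BINDING a `₉CB10` record's world by the Y-pinned C-binding (any floor, any operator layer) gives a record of this module with the SAME datum.
[cite: Balaban1985BackgroundPropagators, Thm 3.1 p.397 (bookkeeping)] -/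
theorem isRecordOfRecord₉CB10YP_rebind_of_isRecordOfRecord₉CB10 (h : IsRecordOfRecord₉CB10 F N D w) (Mstar : ℕ) :
    ∃ (θ : Stage9Params F N) (_ : θ.Provisos), θ.Admissible ∧ (∀ P, w.up P = upOfRecord₅C F N ((θ.toStage5 F N).pinB10 F N) P) ∧
      ∀ ops : OpsY N θ.toStage3Params Mstar,
        IsRecordOfRecord₉CB10YP F N D
          { w with up := fun P => upOfRecord₅C F N (((θ.toStage5 F N).pinB10 F N).pinY F N (Y9OfRecordP N θ.toStage3Params Mstar ops)) P } := by
  obtain ⟨θ, hP, hθ, hD, hC, hγ, hL, hup⟩ := h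
  exact ⟨θ, hP, hθ, hup, fun ops => ⟨θ, hP, Mstar, ops, hθ, hD, hC, hγ, hL, fun _ => rfl⟩⟩

/-- **THE `b9` LEAF AT A RECORD OF THIS MODULE IS def-Y's LEAF AT THE BUNDLE OF RECORD**: for the record's Stage-3 dictionary, floor and operator layer,
`(leavesP w P).b9 ↔ B9LeafX (Y9OfRecordP N θ₃ Mstar ops)` at every run — so def-Y's knit `B9PinCarriersKLevelV1P.b9LeafX_carriersYP` (geometric hypotheses discharged, the
operator layer's obligations displayed) is the closer BY NAME. [cite: Balaban1985BackgroundPropagators, Thms 3.1–3.15 pp.397–432] -/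
theorem leaf_b9_iff_of_isRecordOfRecord₉CB10YP (h : IsRecordOfRecord₉CB10YP F N D w) :
    ∃ (θ₃ : Stage3Params) (Mstar : ℕ) (ops : OpsY N θ₃ Mstar), θ₃.toStage1Params.Admissible ∧ w.L = (θ₃.L : ℝ) ∧
      ∀ P : B12.RunParams, (leavesP w P).b9 ↔ B9LeafX (Y9OfRecordP N θ₃ Mstar ops) := by
  obtain ⟨θ, -, Mstar, ops, hθ, -, -, -, hL, hup⟩ := h
  refine ⟨θ.toStage3Params, Mstar, ops, hθ.1.1.1.1, hL, fun P => ?_⟩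
  show (w.up P).b9 ↔ _
  rw [hup P]
  exact upOfRecord₅C_pinY_b9_iff F N _ _ P

/-- **N06 at a record of this module, «SLOTS» FORM** (the shape of `B10RunsOfRecord.b10_main_of_isRecordOfRecord₅C_of_runsOfRecordG`): if for every parameter
package `(θ, h, Mstar, ops)` presenting `(D, w)` as a record of this module the [B9] leaf holds at the bundle of record — which is what def-Y's knit
`B9PinCarriersKLevelV1P.b9LeafX_carriersYP` delivers from the operator layer's displayed obligations and `N03Record.b6BlockParam_D6OfRecord` — then `Dag.B9_main` holds at
every run (in-edges unused).  The hypothesis quantifies over the HIDDEN operator layer: honest, and exactly why N06 is not bookable in ∀-form here.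
[cite: Balaban1985BackgroundPropagators, Thms 3.1–3.15 pp.397–432 (the node's shape `Dag.B9_main`, bookkeeping)] -/
theorem b9_main_of_isRecordOfRecord₉CB10YP_of_slots (h : IsRecordOfRecord₉CB10YP F N D w)
    (hops : ∀ (θ : Stage9Params F N) (hP : θ.Provisos) (Mstar : ℕ) (ops : OpsY N θ.toStage3Params Mstar), θ.Admissible →
      D = datumOfRecord₉ F N θ hP →
      (∀ P, w.up P = upOfRecord₅C F N (((θ.toStage5 F N).pinB10 F N).pinY F N (Y9OfRecordP N θ.toStage3Params Mstar ops)) P) →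
        B9LeafX (Y9OfRecordP N θ.toStage3Params Mstar ops))
    (P : B12.RunParams) : Dag.B9_main (leavesP w P) := by
  obtain ⟨θ, hP, Mstar, ops, hθ, hD, -, -, -, hup⟩ := h
  intro _ _ _ _
  show (w.up P).b9
  rw [hup P]
  exact (upOfRecord₅C_pinY_b9_iff F N _ _ P).2 (hops θ hP Mstar ops hθ hD hup)

/-- The [B10] pin's face SURVIVES the cumulative pin: at every record of this module `(leavesP w P).b10 ↔ PrintedUV3V N L` with `L` the world's block size.
[cite: Balaban1985UV3, Thm 1 p.257 (compact reading) + Thm 2 p.272] -/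
theorem leaf_b10_iff_of_isRecordOfRecord₉CB10YP (h : IsRecordOfRecord₉CB10YP F N D w) :
    ∃ L : ℕ, (Odd L ∧ 1 < L) ∧ w.L = (L : ℝ) ∧ ∀ P : B12.RunParams, (leavesP w P).b10 ↔ PrintedUV3V N L := by
  obtain ⟨θ, -, Mstar, ops, -, -, -, -, hL, hup⟩ := h
  refine ⟨θ.L, θ.hL, hL, fun P => ?_⟩
  show (w.up P).b10 ↔ _
  rw [hup P, upOfRecord₅C_pinY_b10]
  exact upOfRecord₅C_pinB10_b10_iff F N (θ.toStage5 F N) P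

end Record9


end Literature.MathematicalPhysics.QuantumFieldTheory.Balaban1983to89.Node00

end
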